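import Summits.QuantumFields.BalabanUV.Beta.EriceRemainderEnclosureHistoryRenewalContinuum

/-!
# EriceRemainderEnclosureHistoryRenewalStretched — (E33g) K-UNIFORM STRETCHED-EXPONENTIAL WITHOUT `FadingMemory`: with windows of
# `⌊√l⌋` scales the renewal of (E33) has the SUPERSOLUTION `L·ρ^⌊√j⌋` — `|1∕(g^A_j)² − 1∕(g^B_{j+1})²| ≤ L·ρ^⌊√j⌋` for EVERY cutoff `K`,
# with `L`, `ρ < 1` depending on `(c, θ, q)` only

Cell `pub-balaban`, β-function sub-cell, BINDER row D4 «RemainderConst leaves for Bałaban's split» (`HOME/BINDER-OWNERS.md`; owner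
lineage `b2b-balaban-beta-an4`; this file by co-owner #2 lineage `b2b-balaban-beta-d4-p2`, generation 35), β-FLOW TEAM duty (1),
FREEZE (0) honoured (def-free; no new leaf, no new hypothesis shape).  The common refinement of (E33c) (stretched-exponential in `j` but
with a factor `2K+2`: fixed window) and (E33f) (K-uniform but quasi-polynomial: dyadic window): the window of row `l` is `Nat.sqrt l`.
By-name inputs: (E33a) `EriceRemainderEnclosureHistoryRenewal.disc_row_split` ∕ `disc_row_full` (row split, ANY window), (E33b)
`EriceRemainderEnclosureHistoryRenewalBlocks.backward_sum_from` ∕ `bound_of_split`, (E33d)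
`EriceRemainderEnclosureHistoryRenewalContinuum.summable_succ_mul_pow_sqrt` (`Σ_n (n+1)κ^⌊√n⌋ < ∞`), (E32) `nearMono_of_sign`, node U2's
`T4CouplingMatching.sum_weights_le_of_eventualLower`.

HONEST FRAMING (page 1, verbatim and binding).  *"Discharging BetaPertH makes Bałaban's UV stability UNCONDITIONAL — a real
constructive-QFT result; it is NOT the continuum limit and NOT the Clay problem."*  THIS FILE DISCHARGES NOTHING OF THE KIND.  Every
β-side input is a NAMED BINDER on an ABSTRACT family `β : FlowStep.HBeta` (node U2's `ScaleShiftRate`, `HistLipschitz` with a row total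
weight, `EventualLowerH`, the sign — NOT PRINTED, GAPS G-t4-U2-1∕-2, NOT asserted for [I] (1.22)); [folklore] real analysis + by-name
composition; nothing of [I] quoted newly.  Row D4 class UNCHANGED (critical-path width 0; instance 0∕1; D4 DISCHARGE NO DATE).  HONEST
DEPENDENCY: continuum YM on T⁴ ⇐ BetaPertH ∧ nine spine estimates (0/9 proved); BetaPertH ⇐ (D1) ∧ (D4) ∧ CAP+tail; G-an2-4 gates asym, D1
and NE2/3/4.

THE MECHANISM.  Row split with window `⌊√l⌋` ((E33a)): `δ_l ≤ δ_{l+1} + a_l + m·w_l·B′`, `a_l = cθ^l + 2cθ^⌊√l⌋∕(1−θ)`, for any bound `B′` of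
`δ` on `[l − ⌊√l⌋, l]`.  Since `l ↦ l − ⌊√l⌋` is monotone (§1 `sub_sqrt_mono`), summing the rows `l ≥ i` gives the renewal
`E(i) ≤ A(i) + q·E(i − ⌊√i⌋)` (§1 `sqrt_window_step`; `A(i) = Σ_{l∈[i,K)} a_l`, NO cutoff factor).  SUPERSOLUTION (§1 `sqrt_supersolution`,
strong induction on `i`): if `q ≤ ρ²`, `0 < ρ ≤ 1`, `δ ≤ L` globally and `A(i) ≤ (1−ρ)·L·ρ^⌊√i⌋`, then `δ_j ≤ L·ρ^⌊√i⌋` on `[i, K]` — because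
`⌊√(i − ⌊√i⌋)⌋ ≥ ⌊√i⌋ − 1` (§1 `sqrt_pred_le_sqrt_sub`), so `q·L·ρ^{⌊√i⌋−1} ≤ ρ·L·ρ^⌊√i⌋` closes against `(1−ρ)·L·ρ^⌊√i⌋`.  SOURCES (§2
`source_tail_le`): for `θ < ρ < 1`, `A(i) ≤ (c∕(1−θ) + (2c∕(1−θ))·S)·ρ^⌊√i⌋` uniformly in `K`, `S = Σ_l (θ∕ρ)^⌊√l⌋ < ∞`.  RUN LEVEL (§3
**`disc_le_sqrt_uniform`**): for constants `(c, θ, ρ, M, A, U)` with `θ < ρ < 1` and `A³·M·U ≤ ρ²` there is ONE `L ≥ 0` such that EVERY pair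
of pinned runs (any `K`, any `β`, `Λ`, `γ` meeting node U2's binder list with rows `≤ M`, near-monotone with constant `A`, `Σu ≤ U`) has
`disc gA gB j ≤ L·ρ^(Nat.sqrt j)` for all `j ≤ K`; **`disc_le_sqrt_uniform_sign`** (`A = 1`, `U = (k₀+1)γ³ + 2γ∕b`, `M·U ≤ ρ²`).  So, without any
decay of the memory in the age, node U2's matching rate is K-UNIFORM and STRETCHED-EXPONENTIAL `L·ρ^⌊√j⌋` in the ultraviolet index; what
`FadingMemory` buys is exactly the GEOMETRIC shape `θ^j` (and the explicit constant `2c∕(1−θ)`).  Whether `ρ^⌊√j⌋` is sharp for an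
admissible family is NOT decided.

WHAT IS PROVED ([folklore]; 0 `def`, 0 sorry): §1 `sub_sqrt_mono`, `sqrt_pred_le_sqrt_sub`, `sqrt_window_step`, `sqrt_supersolution`;
§2 `summable_pow_sqrt`, `source_tail_le`; §3 `disc_le_sqrt_uniform`, `disc_le_sqrt_uniform_sign`, `tendsto_invSq_tail_of_uniform` (the continuum
recursion variable with the K-uniform tail `Σ_k L·ρ^⌊√(n+k)⌋` — decay-free counterpart of `T4ContinuumCoupling.abs_invSq_sub_astar_le`).
-/

noncomputable section
open Finset Filter Topology

namespace Summit.QuantumFields.BalabanUV.Beta.EriceRemainderEnclosureHistoryRenewalStretched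

open Literature.MathematicalPhysics.QuantumFieldTheory.Balaban1983to89
open Literature.MathematicalPhysics.QuantumFieldTheory.Balaban1983to89.FlowStep
open Literature.MathematicalPhysics.QuantumFieldTheory.Balaban1983to89.T4CouplingMatching
open Summit.QuantumFields.BalabanUV.Beta.EriceRemainderEnclosureHistoryUniqueness (nearMono_of_sign sign_along_of_betaLowerH)
open Summit.QuantumFields.BalabanUV.Beta.EriceRemainderEnclosureHistoryRenewal (disc_row_split disc_row_full)
open Summit.QuantumFields.BalabanUV.Beta.EriceRemainderEnclosureHistoryRenewalBlocks (backward_sum_from bound_of_split)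
open Summit.QuantumFields.BalabanUV.Beta.EriceRemainderEnclosureHistoryRenewalContinuum (summable_succ_mul_pow_sqrt)
open Literature.MathematicalPhysics.QuantumFieldTheory.Balaban1983to89.T4ContinuumCoupling (invSq astar abs_invSq_succ_sub)

/-! ## §1 The square-root renewal and its supersolution (abstract real sequences) -/

/-- `l ↦ l − ⌊√l⌋` is monotone (`⌊√(l+1)⌋ ≤ ⌊√l⌋ + 1`). [folklore] -/
theorem sub_sqrt_mono {i l : ℕ} (h : i ≤ l) : i - Nat.sqrt i ≤ l - Nat.sqrt l := by
  have hmono : Monotone (fun n : ℕ => n - Nat.sqrt n) := by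
    refine monotone_nat_of_le_succ fun n => ?_
    have h1 : Nat.sqrt (n + 1) ≤ Nat.sqrt n + 1 := Nat.sqrt_succ_le_succ_sqrt n
    have h2 : Nat.sqrt n ≤ n := Nat.sqrt_le_self n
    show n - Nat.sqrt n ≤ n + 1 - Nat.sqrt (n + 1)
    omega
  exact hmono h

/-- `⌊√i⌋ − 1 ≤ ⌊√(i − ⌊√i⌋)⌋` (`(s−1)² + s ≤ s² ≤ i` for `s = ⌊√i⌋ ≥ 1`). [folklore] -/
theorem sqrt_pred_le_sqrt_sub (i : ℕ) : Nat.sqrt i - 1 ≤ Nat.sqrt (i - Nat.sqrt i) := by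
  rcases Nat.eq_zero_or_pos (Nat.sqrt i) with h0 | hpos
  · rw [h0]; exact Nat.zero_le _
  · obtain ⟨t, ht⟩ : ∃ t, Nat.sqrt i = t + 1 := ⟨Nat.sqrt i - 1, by omega⟩
    have hsq := Nat.sqrt_le i
    rw [ht] at hsq ⊢
    rw [Nat.add_sub_cancel]
    refine Nat.le_sqrt.2 ?_
    have h1 : t * t + 2 * t + 1 ≤ i := by nlinarith [hsq]
    have h2 : t + 1 ≤ i := by nlinarith [h1]
    rw [Nat.le_sub_iff_add_le h2]
    linarith

/-- **SQUARE-ROOT WINDOW STEP**: rows splitting over the windows `[l − ⌊√l⌋, l]`, a bound `B ≥ 0` of `δ` on `[i − ⌊√i⌋, K]` ⟹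
`δ_j ≤ Σ_{l∈[i,K)} a_l + m·U·B` on `[i, K]` — NO cutoff factor. [folklore] -/
theorem sqrt_window_step {K : ℕ} {δ a w : ℕ → ℝ} {m U B : ℝ}
    (hw : ∀ i, i ≤ K → 0 ≤ w i) (hm : 0 ≤ m) (ha : ∀ i, 0 ≤ a i)
    (hU : ∑ j ∈ range (K + 1), w j ≤ U) (hK : δ K = 0) (hB : 0 ≤ B)
    (hrec : ∀ l, l < K → ∀ B' : ℝ, (∀ i, l - Nat.sqrt l ≤ i → i ≤ l → δ i ≤ B') → δ l ≤ δ (l + 1) + a l + m * w l * B')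
    {i : ℕ} (hbound : ∀ i', i - Nat.sqrt i ≤ i' → i' ≤ K → δ i' ≤ B) :
    ∀ j, i ≤ j → j ≤ K → δ j ≤ (∑ l ∈ Ico i K, a l) + m * U * B := by
  have hstep : ∀ l, i ≤ l → l < K → δ l ≤ δ (l + 1) + (a l + m * w l * B) := by
    intro l hil hlK
    have h := hrec l hlK B (fun i' hi1 hi2 => hbound i' ((sub_sqrt_mono hil).trans hi1) (by omega))
    linarith
  intro j hij hjK
  have h1 := backward_sum_from (s := fun l => a l + m * w l * B) (le_of_eq hK) hstep j hij hjK
  have h2 : ∑ l ∈ Ico j K, (a l + m * w l * B) = (∑ l ∈ Ico j K, a l) + m * B * ∑ l ∈ Ico j K, w l := by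
    rw [sum_add_distrib, mul_sum]; exact congrArg _ (sum_congr rfl fun l _ => by ring)
  have h3 : ∑ l ∈ Ico j K, a l ≤ ∑ l ∈ Ico i K, a l :=
    sum_le_sum_of_subset_of_nonneg (Ico_subset_Ico hij le_rfl) fun l _ _ => ha l
  have h4 : ∑ l ∈ Ico j K, w l ≤ U :=
    (sum_le_sum_of_subset_of_nonneg (fun l hl => mem_range.mpr (by have := (mem_Ico.mp hl).2; omega))
      (fun l hl _ => hw l (Nat.lt_succ_iff.mp (mem_range.mp hl)))).trans hU
  have h5 : m * B * ∑ l ∈ Ico j K, w l ≤ m * B * U := mul_le_mul_of_nonneg_left h4 (mul_nonneg hm hB)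
  calc δ j ≤ ∑ l ∈ Ico j K, (a l + m * w l * B) := h1
    _ = (∑ l ∈ Ico j K, a l) + m * B * ∑ l ∈ Ico j K, w l := h2
    _ ≤ (∑ l ∈ Ico i K, a l) + m * U * B := by nlinarith [h3, h5]

/-- **THE SUPERSOLUTION `L·ρ^⌊√i⌋`**: under the square-root split, with `q = m·U ≤ ρ²`, `0 < ρ ≤ 1`, a global bound `δ ≤ L` on `[0, K]` and
source tails `Σ_{l∈[i,K)} a_l ≤ (1−ρ)·L·ρ^⌊√i⌋`: `δ_j ≤ L·ρ^⌊√i⌋` for all `i ≤ j ≤ K` (strong induction on `i`; the step loses one unit of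
`⌊√·⌋`, paid by `q ≤ ρ²`). [folklore] -/
theorem sqrt_supersolution {K : ℕ} {δ a w : ℕ → ℝ} {m U L ρ : ℝ}
    (hw : ∀ i, i ≤ K → 0 ≤ w i) (hm : 0 ≤ m) (ha : ∀ i, 0 ≤ a i)
    (hU : ∑ j ∈ range (K + 1), w j ≤ U) (hK : δ K = 0)
    (hρ0 : 0 < ρ) (hρ1 : ρ ≤ 1) (hqρ : m * U ≤ ρ ^ 2) (hL : ∀ i, i ≤ K → δ i ≤ L)
    (hA : ∀ i, i ≤ K → ∑ l ∈ Ico i K, a l ≤ (1 - ρ) * L * ρ ^ Nat.sqrt i)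
    (hrec : ∀ l, l < K → ∀ B' : ℝ, (∀ i, l - Nat.sqrt l ≤ i → i ≤ l → δ i ≤ B') → δ l ≤ δ (l + 1) + a l + m * w l * B') :
    ∀ i j, i ≤ j → j ≤ K → δ j ≤ L * ρ ^ Nat.sqrt i := by
  have hL0 : 0 ≤ L := by have := hL K le_rfl; rw [hK] at this; exact this
  intro i
  induction i using Nat.strong_induction_on with
  | _ i ih =>
    intro j hij hjK
    rcases Nat.eq_zero_or_pos (Nat.sqrt i) with hs0 | hs
    · rw [hs0, pow_zero, mul_one]; exact hL j hjK
    · have hi1 : 1 ≤ i := Nat.sqrt_pos.mp hs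
      have hlt : i - Nat.sqrt i < i := Nat.sub_lt (by omega) hs
      have hB0 : 0 ≤ L * ρ ^ Nat.sqrt (i - Nat.sqrt i) := mul_nonneg hL0 (pow_nonneg hρ0.le _)
      have hstep := sqrt_window_step hw hm ha hU hK hB0 hrec (i := i)
        (fun i' hi1' hi2' => ih (i - Nat.sqrt i) hlt i' hi1' hi2') j hij hjK
      have hAi := hA i (hij.trans hjK)
      -- the lost unit of √: ρ^{⌊√(i−⌊√i⌋)⌋} ≤ ρ^{⌊√i⌋ − 1}
      have hpow : ρ ^ Nat.sqrt (i - Nat.sqrt i) ≤ ρ ^ (Nat.sqrt i - 1) :=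
        pow_le_pow_of_le_one hρ0.le hρ1 (sqrt_pred_le_sqrt_sub i)
      have hkey : m * U * (L * ρ ^ Nat.sqrt (i - Nat.sqrt i)) ≤ ρ * (L * ρ ^ Nat.sqrt i) := by
        calc m * U * (L * ρ ^ Nat.sqrt (i - Nat.sqrt i)) ≤ ρ ^ 2 * (L * ρ ^ (Nat.sqrt i - 1)) :=
              mul_le_mul hqρ (mul_le_mul_of_nonneg_left hpow hL0) hB0 (sq_nonneg ρ)
          _ = ρ * (L * (ρ ^ (Nat.sqrt i - 1) * ρ)) := by ring
          _ = ρ * (L * ρ ^ Nat.sqrt i) := by rw [← pow_succ, Nat.sub_add_cancel hs]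
      calc δ j ≤ (∑ l ∈ Ico i K, a l) + m * U * (L * ρ ^ Nat.sqrt (i - Nat.sqrt i)) := hstep
        _ ≤ (1 - ρ) * L * ρ ^ Nat.sqrt i + ρ * (L * ρ ^ Nat.sqrt i) := add_le_add hAi hkey
        _ = L * ρ ^ Nat.sqrt i := by ring

/-! ## §2 The square-root source tails are K-uniform -/

/-- `Σ_l κ^⌊√l⌋ < ∞` for `0 ≤ κ < 1` ((E33d) `summable_succ_mul_pow_sqrt` BY NAME, `κ^⌊√l⌋ ≤ (l+1)κ^⌊√l⌋`). [folklore] -/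
theorem summable_pow_sqrt {κ : ℝ} (hκ0 : 0 ≤ κ) (hκ1 : κ < 1) : Summable (fun l : ℕ => κ ^ Nat.sqrt l) := by
  refine Summable.of_nonneg_of_le (fun l => pow_nonneg hκ0 _) (fun l => ?_) (summable_succ_mul_pow_sqrt hκ0 hκ1)
  have h1 : (1 : ℝ) ≤ (l : ℝ) + 1 := by have := (Nat.cast_nonneg l : (0 : ℝ) ≤ l); linarith
  calc κ ^ Nat.sqrt l = 1 * κ ^ Nat.sqrt l := (one_mul _).symm
    _ ≤ ((l : ℝ) + 1) * κ ^ Nat.sqrt l := mul_le_mul_of_nonneg_right h1 (pow_nonneg hκ0 _)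

/-- **SOURCE TAILS**: for `0 ≤ θ < ρ < 1`, `c ≥ 0` and every `i ≤ K`,
`Σ_{l∈[i,K)} (cθ^l + 2cθ^⌊√l⌋∕(1−θ)) ≤ (c∕(1−θ) + (2c∕(1−θ))·S)·ρ^⌊√i⌋` with `S = Σ_l (θ∕ρ)^⌊√l⌋` — uniformly in `K` (any `i`, `K`)
(`θ^l ≤ ρ^l ≤ ρ^⌊√i⌋` and `θ^⌊√l⌋ = (θ∕ρ)^⌊√l⌋·ρ^⌊√l⌋ ≤ (θ∕ρ)^⌊√l⌋·ρ^⌊√i⌋` for `l ≥ i`). [folklore] -/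
theorem source_tail_le {c θ ρ : ℝ} (hc : 0 ≤ c) (hθ0 : 0 ≤ θ) (hθρ : θ < ρ) (hρ1 : ρ < 1) (i K : ℕ) :
    ∑ l ∈ Ico i K, (c * θ ^ l + 2 * (c * θ ^ Nat.sqrt l / (1 - θ)))
      ≤ (c / (1 - θ) + 2 * c / (1 - θ) * ∑' l : ℕ, (θ / ρ) ^ Nat.sqrt l) * ρ ^ Nat.sqrt i := by
  have hρ0 : 0 < ρ := hθ0.trans_lt hθρ
  have hθ1 : θ < 1 := hθρ.trans hρ1
  have h1θ : 0 < 1 - θ := by linarith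
  have hκ0 : 0 ≤ θ / ρ := div_nonneg hθ0 hρ0.le
  have hκ1 : θ / ρ < 1 := (div_lt_one hρ0).mpr hθρ
  have hS := summable_pow_sqrt hκ0 hκ1
  set S := ∑' l : ℕ, (θ / ρ) ^ Nat.sqrt l with hSdef
  have hS0 : 0 ≤ S := tsum_nonneg fun l => pow_nonneg hκ0 _
  have hsi : Nat.sqrt i ≤ i := Nat.sqrt_le_self i
  rw [sum_add_distrib]
  -- geometric part
  have hg : ∑ l ∈ Ico i K, c * θ ^ l ≤ c / (1 - θ) * ρ ^ Nat.sqrt i := by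
    rw [← mul_sum]
    have hθi : θ ^ i ≤ ρ ^ Nat.sqrt i :=
      (pow_le_pow_left₀ hθ0 hθρ.le i).trans (pow_le_pow_of_le_one hρ0.le hρ1.le hsi)
    calc c * ∑ l ∈ Ico i K, θ ^ l ≤ c * (θ ^ i / (1 - θ)) := mul_le_mul_of_nonneg_left (geom_sum_Ico_le_of_lt_one hθ0 hθ1) hc
      _ ≤ c * (ρ ^ Nat.sqrt i / (1 - θ)) := mul_le_mul_of_nonneg_left (div_le_div_of_nonneg_right hθi h1θ.le) hc
      _ = c / (1 - θ) * ρ ^ Nat.sqrt i := by ring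
  -- square-root part
  have hr : ∑ l ∈ Ico i K, 2 * (c * θ ^ Nat.sqrt l / (1 - θ)) ≤ 2 * c / (1 - θ) * S * ρ ^ Nat.sqrt i := by
    have e : ∑ l ∈ Ico i K, 2 * (c * θ ^ Nat.sqrt l / (1 - θ)) = 2 * c / (1 - θ) * ∑ l ∈ Ico i K, θ ^ Nat.sqrt l := by
      rw [mul_sum]; exact sum_congr rfl fun l _ => by ring
    rw [e, mul_assoc]
    refine mul_le_mul_of_nonneg_left ?_ (by positivity)
    have hpt : ∀ l ∈ Ico i K, θ ^ Nat.sqrt l ≤ (θ / ρ) ^ Nat.sqrt l * ρ ^ Nat.sqrt i := by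
      intro l hl
      have hil : i ≤ l := (mem_Ico.mp hl).1
      have e2 : θ ^ Nat.sqrt l = (θ / ρ) ^ Nat.sqrt l * ρ ^ Nat.sqrt l := by
        rw [← mul_pow, div_mul_cancel₀ _ hρ0.ne']
      rw [e2]
      exact mul_le_mul_of_nonneg_left (pow_le_pow_of_le_one hρ0.le hρ1.le (Nat.sqrt_le_sqrt hil)) (pow_nonneg hκ0 _)
    calc ∑ l ∈ Ico i K, θ ^ Nat.sqrt l ≤ ∑ l ∈ Ico i K, (θ / ρ) ^ Nat.sqrt l * ρ ^ Nat.sqrt i := sum_le_sum hpt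
      _ = (∑ l ∈ Ico i K, (θ / ρ) ^ Nat.sqrt l) * ρ ^ Nat.sqrt i := by rw [sum_mul]
      _ ≤ S * ρ ^ Nat.sqrt i := by
          refine mul_le_mul_of_nonneg_right ?_ (pow_nonneg hρ0.le _)
          exact hS.sum_le_tsum (Ico i K) (fun l _ => pow_nonneg hκ0 _)
  calc ∑ l ∈ Ico i K, c * θ ^ l + ∑ l ∈ Ico i K, 2 * (c * θ ^ Nat.sqrt l / (1 - θ))
      ≤ c / (1 - θ) * ρ ^ Nat.sqrt i + 2 * c / (1 - θ) * S * ρ ^ Nat.sqrt i := add_le_add hg hr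
    _ = (c / (1 - θ) + 2 * c / (1 - θ) * S) * ρ ^ Nat.sqrt i := by ring

/-! ## §3 Run level: K-uniform stretched-exponential matching WITHOUT `FadingMemory` -/

/-- **NODE U2 WITHOUT FADING MEMORY — K-UNIFORM STRETCHED-EXPONENTIAL RATE.**  Fix constants `c ≥ 0`, `0 ≤ θ < ρ < 1`, `M ≥ 0`, `A ≥ 0`,
`U` with `A³·M·U ≤ ρ²`.  There is ONE constant `L ≥ 0` such that for EVERY history family `β` with `ScaleShiftRate c θ γ β` and
`HistLipschitz Λ γ β` (`Λ ≥ 0`, rows `≤ M`), EVERY cutoff `K` and EVERY pair of pinned runs of (0.20) (`K` and `K + 1` steps in ]0,γ],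
near-monotone with constant `A`, AF weight sum `≤ U`): `|1∕(g^A_j)² − 1∕(g^B_{j+1})²| ≤ L·ρ^(Nat.sqrt j)` for all `j ≤ K`.  NO `FadingMemory`,
NO cutoff factor.  (`L = max(c∕((1−θ)(1−q)), A₀∕(1−ρ))`, `A₀ = c∕(1−θ) + (2c∕(1−θ))·Σ_l (θ∕ρ)^⌊√l⌋`.) [cite: Balaban1987RG1, (0.20) p.256 and §5 p.298] -/
theorem disc_le_sqrt_uniform {c θ ρ M A U : ℝ} (hc : 0 ≤ c) (hθ0 : 0 ≤ θ) (hθρ : θ < ρ) (hρ1 : ρ < 1)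
    (hM : 0 ≤ M) (hA0 : 0 ≤ A) (hqρ : A ^ 3 * M * U ≤ ρ ^ 2) :
    ∃ L : ℝ, 0 ≤ L ∧ ∀ (β : HBeta) (Λ : ℕ → ℕ → ℝ) (γ : ℝ) (K : ℕ) (gA gB : ℕ → ℝ),
      RGEqH K β gA → RGEqH (K + 1) β gB →
      (∀ i, i ≤ K → 0 < gA i ∧ gA i ≤ γ) → (∀ i, i ≤ K + 1 → 0 < gB i ∧ gB i ≤ γ) → gA K = gB (K + 1) →
      ScaleShiftRate c θ γ β → HistLipschitz Λ γ β → (∀ k i, i ≤ k → 0 ≤ Λ k i) →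
      (∀ k, ∑ i ∈ range (k + 1), Λ k i ≤ M) →
      (∀ i j, i ≤ j → j ≤ K → gA i ≤ A * gA j) → (∀ i j, i ≤ j → j ≤ K + 1 → gB i ≤ A * gB j) →
      (∑ i ∈ range (K + 1), (gA i) ^ 2 * gB (i + 1) ≤ U) →
      ∀ j, j ≤ K → disc gA gB j ≤ L * ρ ^ Nat.sqrt j := by
  have hρ0 : 0 < ρ := hθ0.trans_lt hθρ
  have hθ1 : θ < 1 := hθρ.trans hρ1
  have h1θ : 0 < 1 - θ := by linarith
  have hq1 : A ^ 3 * M * U < 1 := lt_of_le_of_lt hqρ (by nlinarith)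
  have h1q : 0 < 1 - A ^ 3 * M * U := by linarith
  have hκ0 : 0 ≤ θ / ρ := div_nonneg hθ0 hρ0.le
  set S := ∑' l : ℕ, (θ / ρ) ^ Nat.sqrt l with hSdef
  have hS0 : 0 ≤ S := tsum_nonneg fun l => pow_nonneg hκ0 _
  set A₀ := c / (1 - θ) + 2 * c / (1 - θ) * S with hA₀
  have hA₀0 : 0 ≤ A₀ := by positivity
  set L := max (c / (1 - θ) / (1 - A ^ 3 * M * U)) (A₀ / (1 - ρ)) with hLdef
  have hL0 : 0 ≤ L := le_max_of_le_left (div_nonneg (div_nonneg hc h1θ.le) h1q.le)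
  refine ⟨L, hL0, ?_⟩
  intro β Λ γ K gA gB hA hB hAbox hBbox hpin hS hL hΛ hrow hmA hmB hU j hj
  have hw : ∀ i, i ≤ K → 0 ≤ (gA i) ^ 2 * gB (i + 1) := fun i hi => mul_nonneg (sq_nonneg _) (hBbox (i + 1) (by omega)).1.le
  have hm : 0 ≤ A ^ 3 * M := mul_nonneg (pow_nonneg hA0 3) hM
  have e3 : A ^ 3 * M * U = (A ^ 3 * M) * U := by ring
  -- global bound
  have hS₀ : ∑ l ∈ range K, c * θ ^ l ≤ c / (1 - θ) := by
    rw [← mul_sum]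
    calc c * ∑ l ∈ range K, θ ^ l ≤ c * (θ ^ 0 / (1 - θ)) := by
          rw [← Nat.Ico_zero_eq_range]; exact mul_le_mul_of_nonneg_left (geom_sum_Ico_le_of_lt_one hθ0 hθ1) hc
      _ = c / (1 - θ) := by rw [pow_zero]; ring
  have hD := bound_of_split (δ := disc gA gB) (a := fun l => c * θ ^ l) (w := fun i => (gA i) ^ 2 * gB (i + 1)) hw hm
    (fun i => mul_nonneg hc (pow_nonneg hθ0 i)) hU (by rw [← e3]; exact hq1) (disc_pin hpin) (disc_nonneg gA gB) hS₀
    (fun j hj B' hB' => disc_row_full hA hB hAbox hBbox hS hL hΛ hrow hA0 hmA hmB hj hB')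
  have hDL : ∀ i, i ≤ K → disc gA gB i ≤ L := fun i hi =>
    (hD i hi).trans (by rw [← e3]; exact le_max_left _ _)
  -- source tails against (1 − ρ)·L
  have hAt : ∀ i, i ≤ K → ∑ l ∈ Ico i K, (c * θ ^ l + 2 * (c * θ ^ Nat.sqrt l / (1 - θ))) ≤ (1 - ρ) * L * ρ ^ Nat.sqrt i := by
    intro i _
    refine (source_tail_le hc hθ0 hθρ hρ1 i K).trans ?_
    refine mul_le_mul_of_nonneg_right ?_ (pow_nonneg hρ0.le _)
    have : A₀ / (1 - ρ) ≤ L := le_max_right _ _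
    rw [div_le_iff₀ (by linarith)] at this
    linarith
  refine sqrt_supersolution (a := fun l => c * θ ^ l + 2 * (c * θ ^ Nat.sqrt l / (1 - θ))) hw hm (fun l => by positivity) hU
    (disc_pin hpin) hρ0 hρ1.le (by rw [← e3]; exact hqρ) hDL hAt ?_ j j le_rfl hj
  intro l hl B' hB'
  have h := disc_row_split (s := Nat.sqrt l) hc hθ0 hθ1 hA hB hAbox hBbox hS hL hΛ hrow hA0 hmA hmB hl hB'
  linarith [h]

/-- **END, SIGN FORM, K-UNIFORM** (`A = 1`): fix `c ≥ 0`, `0 ≤ θ < ρ < 1`, `γ, b > 0`, `k₀`, `M ≥ 0` with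
`M·((k₀+1)γ³ + 2γ∕b) ≤ ρ²`.  There is ONE `L ≥ 0` such that for every `β` with `ScaleShiftRate c θ γ β`, `HistLipschitz Λ γ β` (rows
`≤ M`), the sign `BetaLowerH 0 γ β` and the floor `EventualLowerH b γ k₀ β`, every cutoff `K` and every pair of pinned runs in ]0,γ]:
`disc gA gB j ≤ L·ρ^(Nat.sqrt j)` for all `j ≤ K` — node U2's matching rate, K-uniform and stretched-exponential, WITHOUT `FadingMemory`
((E32) `nearMono_of_sign`, node U2's `sum_weights_le_of_eventualLower` BY NAME). [cite: Balaban1987RG1, (0.20) p.256 and (0.31) p.259] -/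
theorem disc_le_sqrt_uniform_sign {c θ ρ γ b M : ℝ} {k₀ : ℕ} (hc : 0 ≤ c) (hθ0 : 0 ≤ θ) (hθρ : θ < ρ) (hρ1 : ρ < 1)
    (hγ : 0 < γ) (hb : 0 < b) (hM : 0 ≤ M) (hqρ : M * (((k₀ : ℝ) + 1) * γ ^ 3 + 2 * γ / b) ≤ ρ ^ 2) :
    ∃ L : ℝ, 0 ≤ L ∧ ∀ (β : HBeta) (Λ : ℕ → ℕ → ℝ) (K : ℕ) (gA gB : ℕ → ℝ),
      RGEqH K β gA → RGEqH (K + 1) β gB →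
      (∀ i, i ≤ K → 0 < gA i ∧ gA i ≤ γ) → (∀ i, i ≤ K + 1 → 0 < gB i ∧ gB i ≤ γ) → gA K = gB (K + 1) →
      ScaleShiftRate c θ γ β → HistLipschitz Λ γ β → (∀ k i, i ≤ k → 0 ≤ Λ k i) →
      (∀ k, ∑ i ∈ range (k + 1), Λ k i ≤ M) → BetaLowerH 0 γ β → EventualLowerH b γ k₀ β →
      ∀ j, j ≤ K → disc gA gB j ≤ L * ρ ^ Nat.sqrt j := by
  obtain ⟨L, hL0, hL⟩ := disc_le_sqrt_uniform (A := 1) (U := ((k₀ : ℝ) + 1) * γ ^ 3 + 2 * γ / b) hc hθ0 hθρ hρ1 hM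
    zero_le_one (by simpa using hqρ)
  refine ⟨L, hL0, ?_⟩
  intro β Λ K gA gB hA hB hAbox hBbox hpin hS hL' hΛ hrow hsign hlo j hj
  exact hL β Λ γ K gA gB hA hB hAbox hBbox hpin hS hL' hΛ hrow
    (nearMono_of_sign hA (fun k hk => (hAbox k hk).1) (sign_along_of_betaLowerH hsign hAbox))
    (nearMono_of_sign hB (fun k hk => (hBbox k hk).1) (sign_along_of_betaLowerH hsign hBbox))
    (sum_weights_le_of_eventualLower hγ hb hA hB hAbox hBbox hlo) j hj

/-- **THE CONTINUUM TAIL WITHOUT `FadingMemory`, K-UNIFORM.**  If a family of runs `K ↦ g K` has the K-uniform stretched shape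
`disc (g K) (g (K+1)) j ≤ L·ρ^(Nat.sqrt j)` (`0 ≤ ρ < 1`; the conclusion of `disc_le_sqrt_uniform`), then at every infrared distance `m`
the recursion variables converge, `invSq g m n → astar g m`, with the EXPLICIT tail `|invSq g m n − astar g m| ≤ Σ_k L·ρ^⌊√(n+k)⌋` — the
decay-free counterpart of `T4ContinuumCoupling.abs_invSq_sub_astar_le`'s geometric `Cθ^n∕(1−θ)` (Mathlib's
`dist_le_tsum_of_dist_le_of_tendsto`; `abs_invSq_succ_sub` BY NAME). [folklore] -/
theorem tendsto_invSq_tail_of_uniform {g : ℕ → ℕ → ℝ} {L ρ : ℝ} (hρ0 : 0 ≤ ρ) (hρ1 : ρ < 1)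
    (hstr : ∀ K j, j ≤ K → disc (g K) (g (K + 1)) j ≤ L * ρ ^ Nat.sqrt j) (m n : ℕ) :
    Tendsto (invSq g m) atTop (𝓝 (astar g m)) ∧ |invSq g m n - astar g m| ≤ ∑' k : ℕ, L * ρ ^ Nat.sqrt (n + k) := by
  have hd : ∀ n, dist (invSq g m n) (invSq g m n.succ) ≤ L * ρ ^ Nat.sqrt n := fun n => by
    rw [Real.dist_eq, abs_sub_comm, abs_invSq_succ_sub]; exact hstr (n + m) n (Nat.le_add_right n m)
  have hsum : Summable (fun n => L * ρ ^ Nat.sqrt n) := (summable_pow_sqrt hρ0 hρ1).mul_left L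
  obtain ⟨a, ha⟩ := cauchySeq_tendsto_of_complete (cauchySeq_of_dist_le_of_summable _ hd hsum)
  have ht : Tendsto (invSq g m) atTop (𝓝 (astar g m)) := tendsto_nhds_limUnder ⟨a, ha⟩
  refine ⟨ht, ?_⟩
  have h := dist_le_tsum_of_dist_le_of_tendsto _ hd hsum ht n
  rwa [Real.dist_eq] at h

end Summit.QuantumFields.BalabanUV.Beta.EriceRemainderEnclosureHistoryRenewalStretched

end
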